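import Summits.BirchSwinnertonDyer.BirchSwinnertonDyer.Theorems.RamifiedSevenEllipticUnitsRubinPackageOfReduced
import Summits.BirchSwinnertonDyer.BirchSwinnertonDyer.Theorems.RamifiedSevenEllipticUnitsLemmaXiFrame
import Summits.BirchSwinnertonDyer.BirchSwinnertonDyer.Theorems.RamifiedSevenEllipticUnitsLemmaXiValuePairs
import Summits.BirchSwinnertonDyer.Rank1Residual.X12.O11.RamifiedRubinPackageReducedLineZp
import Summits.BirchSwinnertonDyer.BirchSwinnertonDyer.Theorems.RamifiedSevenEllipticUnitsQuadraticRamificationAway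
import Literature.NumberTheory.EllipticCurves.ComplexMultiplicationDeuringGrossencharacter
import HarnessLib

set_option linter.dupNamespace false
set_option autoImplicit false

/-!
# Route `RamifiedSevenEllipticUnits` (K7r), Value crux `EllipticUnitValueSevenOfGZK`
# (stmt-BirchSwinnertonDyer-19945), line `rubin-formula-zp`: THE v4.2 ASSEMBLY — `S_pkg` from the reduced
# package `S_pkg⁻`, the three PRINT named facts (Hecke's functional equation, Gross (8.2.7) via H_QR,
# Deuring's theorem WITH the values at the good primes), PURE RIGIDITY of the pinned characters and the
# quadratic-ramification input — the classical stub H_V of v4.1 ELIMINATED in the kernel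
# (cell `bsd-cm`; line owner `bsd-cm-k7r-c4` g9 over seats k7r-c2 g7 (LEMMA Ξ files (I)–(VIII)) and k7r-c3
# g10/g11; helper `--supports` 19945; THEOREMS ONLY, nothing asserted)

Skeleton v4.1 (`8612b7bbe22dc698`) displays H_V (`stub_acCharacterValuesSeven`: the values of `φ(φ∘c)⁻¹`
for every Deuring-type pinned character). Seat k7r-c2 g7 proved (P1) ∧ (P5) for EVERY Rubin datum over a
character of DEURING SHAPE — conj-equivariant, with values `σ'(α_w)`, `(α_w) = w`, off a finite set — from
the O11 frame alone (`RubinPadicLFunctionData.ξ_eq_φac_and_norm_sq_of_frame`, file (VIII); Landau 1918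
for the equality place, file (VI)), and the typing layer landed Deuring's theorem WITH THE VALUES as a named
fact (`Deuring_exists_heckeCharacter_of_maximalCM_withGenerators`, littype W50). Hence H_V is not needed:
* §1 `exists_deuringCharacter_of_cmFieldDiscr` — for EVERY curve `V` with CM field `ℚ(√−7)` (both
  `j = −3375` and `j = 255³`: k7r-c3's `exists_isogenous_maximal_model`, same `L`-series) and every `c ≠ 1`
  of an imaginary quadratic `K` with `d_K = −7`: a character `ψ` of type `(1,0)`, conj-equivariant, pinned to
  `V`, WITH Deuring-shaped values — from the named fact;
* §2 transport of the Deuring shape to `ψ ∘ c` (`isHeckeConjEquivariant_galConj` over k7r-c3's `galConj_galConj_self_of_finrank_eq_two`, `deuringValues_galConj`: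
  values w.r.t. `σ ∘ c`, by `IsHeckeConjEquivariant.valueAtUniformizer_galConj'` and `\overline{σ} = σ ∘ c`);
* §3 `pinnedCharacterStructure_of_deuring_of_rigidity` — v4.1's H_Rig (`RamifiedCMPinnedCharacterStructureAtZp`)
  FOLLOWS from the Deuring fact and PURE rigidity H_Rig⁰ (`RamifiedCMPinnedCharacterRigidityAtZp`);
* §4 **`rubinPackage_of_facts_of_rigidity_of_reduced`** — `S_pkg W 7 D₀` from: Hecke's functional
  equation (named fact), Deuring-with-values (named fact), H_Rig⁰, H_QR (which the skeleton derives from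
  Gross (8.2.7) + H_QR-away, `QuadraticRamificationOfGross`, p507772), and `S_pkg⁻`: the telescope's `φ`,
  `φ₀` are `ψ`, `ψ∘c` (resp. `ψ₀`, `ψ₀∘c`) by H_Rig⁰; (P1)/(P5) by k7r-c2's frame theorem on the Deuring
  shape (transported for the `∘c` orientation); (P2) by `exists_isCentralRootNumberWt_pow` + the galConj
  transport of p505799; (P3) by H_QR + its galConj transport; k7r-c3's reduction assembles.
CONDITIONAL on the displayed inputs; nothing about [BKNO]'s objects, Hecke's, Gross's or Deuring's
theorems is asserted; 19945 stays OPEN; BSD is not proved for any curve.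
[cite: BurungaleKobayashiNakamuraOta2026, Def. 4.2, Def. 4.7, Thm. 4.12, Thm. 7.2 (arXiv:2608.06879 pp. 24, 27, 32, 41; claim; preprint; shape only)]
[cite: SilvermanATAEC1994, Ch. II Thm. 9.2, Prop. 10.4, Cor. 10.4.1 (a), Thm. 10.5 (Deuring's theorem with values)]
[cite: deShalit1987, II.1.1 (1)–(3) (Hecke's functional equation)] [cite: Landau1918Idealklassen, §1 Satz]
-/

noncomputable section

open scoped Classical ComplexConjugate

open WeierstrassCurve NumberField IsDedekindDomain Field PowerSeries
  Literature.NumberTheory.EllipticCurves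
  Literature.NumberTheory.EllipticCurves.Rank1Residual
  Literature.NumberTheory.EllipticCurves.Rank1Residual.Typed
  Literature.NumberTheory.EllipticCurves.Castella2018
  Literature.NumberTheory.EllipticCurves.BurungaleKobayashiNakamuraOta2026
  Literature.NumberTheory.GaloisRepresentations
  Literature.NumberTheory.DiophantineGeometry
  Summit.BirchSwinnertonDyer.Rank1Residual.Additive



namespace Summit.BirchSwinnertonDyer.BirchSwinnertonDyer.Theorems.RamifiedSevenEllipticUnits

namespace RubinPackageOfRigidity

open Summit.BirchSwinnertonDyer.Rank1Residual Summit.BirchSwinnertonDyer.Rank1Residual.X12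
  Summit.BirchSwinnertonDyer.Rank1Residual.X12.O11 RubinPackageOfReduced

/-! ## §1 Deuring characters with values for every curve with CM field `ℚ(√−7)` -/

section Deuring

variable {K : Type} [Field K] [NumberField K]

/-- **Deuring's character WITH VALUES for every curve with CM field `ℚ(√−7)`.** For `V/ℚ` with CM and
`cmFieldDiscrOfJ V.j = −7` (so `j(V) ∈ {−3375, 255³}`), `K` imaginary quadratic with `d_K = −7` and
`c ≠ 1`: there is a Hecke character `ψ` of `K` of infinity type `(1,0)`, conj-equivariant for `c`, pinned
to `V`, and an embedding `σ : K → ℂ` such that at every unramified `w`, `ψ(ϖ_w) = σ(α)` with `(α) = w`.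
From the named fact `Deuring_exists_heckeCharacter_of_maximalCM_withGenerators` at the isogenous globally
minimal maximal-order model `V₁` (k7r-c3 g11 `QuadraticRamification.exists_isogenous_maximal_model`: same
CM field, SAME `L`-series) with `IsCMFieldOfJ K V₁.j` (`QuadraticRamification.isCMFieldOfJ_of_discr_eq`).
CONDITIONAL on the named fact (hypothesis `hD`). [cite: SilvermanATAEC1994, Ch. II Thm. 9.2, Prop. 10.4, Cor. 10.4.1 (a), Thm. 10.5 (b)] -/
theorem exists_deuringCharacter_of_cmFieldDiscr
    (hD : Deuring_exists_heckeCharacter_of_maximalCM_withGenerators)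
    {V : WeierstrassCurve ℚ} [V.IsElliptic] (hVcm : V.HasCM) (hVj : cmFieldDiscrOfJ V.j = -7)
    (hK : IsImaginaryQuadratic K) (hdK : NumberField.discr K = -7) (c : K ≃ₐ[ℚ] K) (hc : c ≠ 1) :
    ∃ ψ : HeckeCharacter K,
      ψ.HasInfinityType (fun _ ↦ 1) (fun _ ↦ 0) ∧ IsHeckeConjEquivariant c ψ ∧
      (∀ s : ℂ, 3 / 2 < s.re → heckeLFunction ψ s = V.LSeries s) ∧
      ∃ σ : K →+* ℂ, ∀ w : HeightOneSpectrum (𝓞 K), ψ.IsUnramifiedAt w →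
        ∃ α : 𝓞 K, Ideal.span {α} = w.asIdeal ∧ ψ.valueAtUniformizer w = σ α := by
  obtain ⟨V₁, _, _, -, hj₁, hd₁, hLV⟩ := QuadraticRamification.exists_isogenous_maximal_model hVcm
  rw [hVj] at hd₁
  have hKj : IsCMFieldOfJ K V₁.j := QuadraticRamification.isCMFieldOfJ_of_discr_eq hj₁ hd₁ hK.1 hdK
  obtain ⟨ψ, hinf, heq, -, -, hL, σ, hσ⟩ := hD V₁ hj₁ K hKj c hc
  refine ⟨ψ, hinf, heq, fun s hs ↦ ?_, σ, hσ⟩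
  rw [hLV]; exact hL s hs

end Deuring

/-! ## §2 Transport of the Deuring shape to `ψ ∘ c` -/

section Transport

variable {K : Type} [Field K] [NumberField K]

/-- From «values at EVERY unramified place» to the Deuring SHAPE «off a finite set: unramified with a
generator value» (the ramified places of a Hecke character are finite: Tate's Lemma 3.2.1, tree
`HeckeCharacter.finite_ramifiedPlaces_holds`). [cite: TateThesis1967, Lemma 3.2.1] -/
theorem deuringShape_of_values {φ : HeckeCharacter K} {σ : K →+* ℂ}
    (h : ∀ w : HeightOneSpectrum (𝓞 K), φ.IsUnramifiedAt w →
      ∃ α : 𝓞 K, Ideal.span {α} = w.asIdeal ∧ φ.valueAtUniformizer w = σ α) :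
    ∃ S : Set (HeightOneSpectrum (𝓞 K)), S.Finite ∧ ∀ w ∉ S,
      φ.IsUnramifiedAt w ∧ ∃ α : 𝓞 K, Ideal.span {α} = w.asIdeal ∧ φ.valueAtUniformizer w = σ (α : K) := by
  have hur : ∀ᶠ v in Filter.cofinite, φ.IsUnramifiedAt v :=
    φ.finite_ramifiedPlaces_iff.1 (HeckeCharacter.finite_ramifiedPlaces_holds φ)
  rw [Filter.eventually_cofinite] at hur
  refine ⟨{v | ¬ φ.IsUnramifiedAt v}, hur, fun w hw ↦ ?_⟩
  have hw' : φ.IsUnramifiedAt w := by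
    simp only [Set.mem_setOf_eq, not_not] at hw
    exact hw
  exact ⟨hw', h w hw'⟩

/-- **`ψ ∘ c` is conj-equivariant when `ψ` is** (quadratic `K`). [cite: Jia2026ActaArith, §1 (equivariant characters; shape only)] -/
theorem isHeckeConjEquivariant_galConj (h2 : Module.finrank ℚ K = 2) {c : K ≃ₐ[ℚ] K}
    {ψ : HeckeCharacter K} (heq : IsHeckeConjEquivariant c ψ) :
    IsHeckeConjEquivariant c (HeckeCharacter.galConj c ψ) := by
  intro x
  rw [QuadraticRamification.galConj_galConj_self_of_finrank_eq_two h2, heq x, Complex.conj_conj]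

/-- **The Deuring shape transports to `ψ ∘ c` with the conjugate embedding `σ ∘ c`**: if `ψ` is
conj-equivariant and `ψ(ϖ_w) = σ(α_w)`, `(α_w) = w` at its unramified places, then `ψ ∘ c` is unramified
at the same places with `(ψ ∘ c)(ϖ_w) = \overline{σ(α_w)} = (σ ∘ c)(α_w)`
(`IsHeckeConjEquivariant.valueAtUniformizer_galConj'`, `conj_embedding_eq_embedding_algEquiv`).
[cite: SilvermanATAEC1994, Ch. II Thm. 9.2 and Cor. 10.4.1 (a) (shape only)] -/
theorem deuringValues_galConj (h2 : Module.finrank ℚ K = 2) {c : K ≃ₐ[ℚ] K} (hc : c ≠ 1)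
    {ψ : HeckeCharacter K} (heq : IsHeckeConjEquivariant c ψ) (σ : K →+* ℂ)
    (hσr : ¬ ComplexEmbedding.IsReal σ)
    (hvals : ∀ w : HeightOneSpectrum (𝓞 K), ψ.IsUnramifiedAt w →
      ∃ α : 𝓞 K, Ideal.span {α} = w.asIdeal ∧ ψ.valueAtUniformizer w = σ α) :
    ∀ w : HeightOneSpectrum (𝓞 K), (HeckeCharacter.galConj c ψ).IsUnramifiedAt w →
      ∃ α : 𝓞 K, Ideal.span {α} = w.asIdeal ∧
        (HeckeCharacter.galConj c ψ).valueAtUniformizer w = (σ.comp (c : K →+* K)) α := by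
  intro w hw
  obtain ⟨α, hα, hv⟩ := hvals w ((heq.isUnramifiedAt_galConj_iff' w).1 hw)
  refine ⟨α, hα, ?_⟩
  rw [heq.valueAtUniformizer_galConj', hv, RingHom.coe_comp, Function.comp_apply,
    LemmaXi.conj_embedding_eq_embedding_algEquiv h2 c hc σ hσr]
  rfl

end Transport

/-! ## §3 v4.1's H_Rig from the Deuring named fact and pure rigidity -/

section Structure

variable {W : WeierstrassCurve ℚ} [W.IsElliptic] [W.IsGloballyMinimal]

omit [W.IsGloballyMinimal] in
/-- **H_Rig ⟸ Deuring-with-values (named fact) ∧ H_Rig⁰ (pure rigidity)** on a curve with CM field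
`ℚ(√−7)`: the existence half of v4.1's `RamifiedCMPinnedCharacterStructureAtZp W 7` is §1, the
uniqueness half is `RamifiedCMPinnedCharacterRigidityAtZp W 7`. CONDITIONAL; nothing booked.
[cite: SilvermanATAEC1994, Ch. II Thm. 9.2 and Thm. 10.5 (Deuring; shape only)] -/
theorem pinnedCharacterStructure_of_deuring_of_rigidity [Fact (Nat.Prime 7)]
    (hD : Deuring_exists_heckeCharacter_of_maximalCM_withGenerators) (hj : cmFieldDiscrOfJ W.j = -7)
    (hrig : RamifiedCMPinnedCharacterRigidityAtZp W 7) :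
    RamifiedCMPinnedCharacterStructureAtZp W 7 := by
  intro K _ _ 𝔭 W' _ _ C hF V _ hVcm hVj cK hcK
  have hK : IsImaginaryQuadratic K := hF.2.2.2.1
  have hdK : NumberField.discr K = -7 := by
    have h := hF.2.2.2.2.1
    rw [hj] at h
    exact h
  obtain ⟨ψ, hinf, heq, hψ, -⟩ :=
    exists_deuringCharacter_of_cmFieldDiscr hD hVcm (hVj.trans hj) hK hdK cK hcK
  exact ⟨ψ, hinf, heq, hψ, fun φ hφ ↦ hrig K 𝔭 W' C hF V hVcm hVj cK hcK ψ φ hinf heq hψ hφ⟩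

end Structure

/-! ## §4 The v4.2 assembly: `S_pkg` without H_V -/

section Assembly

variable {W : WeierstrassCurve ℚ} [W.IsElliptic] [W.IsGloballyMinimal] {D₀ : ℤ}

omit [W.IsGloballyMinimal] in
/-- **THE v4.2 ASSEMBLY: Hecke FE (fact) → Deuring-with-values (fact) → H_Rig⁰ → H_QR → S_pkg⁻ → S_pkg
at `p = 7`** for a curve with CM field `ℚ(√−7)` and a base twist parameter `D₀ ≠ 0`. Inside `S_pkg`'s
telescope: destructure `S_pkg⁻`; §1 gives Deuring characters `ψ`, `ψ₀` WITH VALUES for the member and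
for the base model; H_Rig⁰ puts the telescope's `φ`, `φ₀` in `{ψ, ψ∘cK}`, `{ψ₀, ψ₀∘cK}`; (P1)/(P5) for
`R`, `R₀` by seat k7r-c2's `RubinPadicLFunctionData.ξ_eq_φac_and_norm_sq_of_frame` on the Deuring shape
(transported by §2 in the `∘cK` orientation); (P2) by `exists_isCentralRootNumberWt_pow` transported along
`galConj`; (P3) by H_QR transported; k7r-c3 g10's reduction closes. CONDITIONAL; nothing booked.
[cite: BurungaleKobayashiNakamuraOta2026, Def. 4.7 and Thm. 4.12 (arXiv:2608.06879 pp. 27, 32; claim; preprint; shape only)]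
[cite: SilvermanATAEC1994, Ch. II Thm. 9.2, Cor. 10.4.1 (a)] [cite: deShalit1987, II.1.1 (1)–(3)] -/
theorem rubinPackage_of_facts_of_rigidity_of_reduced [Fact (Nat.Prime 7)]
    (hj : cmFieldDiscrOfJ W.j = -7) (hD₀ : D₀ ≠ 0)
    (hHecke : Hecke_functionalEquation_infinityType)
    (hD : Deuring_exists_heckeCharacter_of_maximalCM_withGenerators)
    (hrig : RamifiedCMPinnedCharacterRigidityAtZp W 7) (hQR : RamifiedCMQuadraticRamificationAtZp W 7)
    (hred : RamifiedCMRubinPackageReducedAtZp W 7 D₀) :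
    RamifiedCMRubinPackageAtZp W 7 D₀ := by
  intro K _ _ 𝔭 W' _ _ C hF hr κ hκ γ _ P n P' n' hP hgen htors hdiv hndiv hP' hgen' htors' hdiv' hndiv'
    q q' hq hq' ι φ Ω 𝓔 D c hΩ hφ hc himc l hl W₀ _ _ hW₀ φ₀ hφ₀ m r hcont hcont₀ hρ hr0 hlt
  obtain ⟨cK, hcK, R, Ω₀, 𝓔₀, D₀', R₀, hΩ₀, hbase, hper, hbottom⟩ :=
    hred K 𝔭 W' C hF hr κ hκ γ P n P' n' hP hgen htors hdiv hndiv hP' hgen' htors' hdiv' hndiv' q q' hq hq'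
      ι φ Ω 𝓔 D c hΩ hφ hc himc l hl W₀ hW₀ φ₀ hφ₀ m r hcont hcont₀ hρ hr0 hlt
  -- the frame: `K = ℚ(√−7)`, `7 ∈ 𝔭`; the member and the base model are CM with field `ℚ(√−7)`
  have hK : IsImaginaryQuadratic K := hF.2.2.2.1
  have h2 : Module.finrank ℚ K = 2 := hK.1
  have hdK : NumberField.discr K = -7 := by
    have h := hF.2.2.2.2.1
    rw [hj] at h
    exact h
  have hdK' : NumberField.discr K = -((7 : ℕ) : ℤ) := by rw [hdK]; norm_num
  have h7 : ((7 : ℕ) : 𝓞 K) ∈ 𝔭.asIdeal := by simpa using hF.2.2.2.2.2.1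
  have hnr : ∀ σ' : K →+* ℂ, ¬ ComplexEmbedding.IsReal σ' :=
    (LemmaXi.frame_fieldInputs (K := K) (p := 7) hK hdK' (by norm_num)).2.2.2.2.1
  have hWcm : W.HasCM := hF.1
  have hW₀cm : W₀.HasCM := RouteU.hasCM_of_twist_cm7 W₀ hD₀ hW₀
  have hW₀j' : cmFieldDiscrOfJ W₀.j = -7 := RouteU.cmFieldDiscrOfJ_of_twist_cm7 W₀ hD₀ hW₀
  have hW₀j : cmFieldDiscrOfJ W₀.j = cmFieldDiscrOfJ W.j := by rw [hW₀j', hj]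
  -- §1: Deuring characters with values; H_Rig⁰: the position of `φ`, `φ₀`
  obtain ⟨ψ, hinf, heq, hψ, σ, hσ⟩ := exists_deuringCharacter_of_cmFieldDiscr hD hWcm hj hK hdK cK hcK
  obtain ⟨ψ₀, hinf₀, heq₀, hψ₀, σ₀, hσ₀⟩ :=
    exists_deuringCharacter_of_cmFieldDiscr hD hW₀cm hW₀j' hK hdK cK hcK
  have hφcase : φ = ψ ∨ φ = HeckeCharacter.galConj cK ψ :=
    hrig K 𝔭 W' C hF W hWcm rfl cK hcK ψ φ hinf heq hψ hφ
  have hφ₀case : φ₀ = ψ₀ ∨ φ₀ = HeckeCharacter.galConj cK ψ₀ :=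
    hrig K 𝔭 W' C hF W₀ hW₀cm hW₀j cK hcK ψ₀ φ₀ hinf₀ heq₀ hψ₀ hφ₀
  -- (P1)/(P5) for `R` and `R₀` from the Deuring shape (k7r-c2's frame theorem), both orientations
  have hP15 : R.ξ = φ * (HeckeCharacter.galConj cK φ)⁻¹ ∧
      ‖avatarValueAt R.r γ - 1‖ ^ 2 = (((7 : ℕ) : ℝ))⁻¹ := by
    rcases hφcase with h | h
    · subst h
      exact RubinPadicLFunctionData.ξ_eq_φac_and_norm_sq_of_frame R hK hdK' (by norm_num) h7 hcK σ heq
        (deuringShape_of_values hσ)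
    · subst h
      exact RubinPadicLFunctionData.ξ_eq_φac_and_norm_sq_of_frame R hK hdK' (by norm_num) h7 hcK
        (σ.comp (cK : K →+* K)) (isHeckeConjEquivariant_galConj h2 heq)
        (deuringShape_of_values (deuringValues_galConj h2 hcK heq σ (hnr σ) hσ))
  have hP15₀ : R₀.ξ = φ₀ * (HeckeCharacter.galConj cK φ₀)⁻¹ ∧
      ‖avatarValueAt R₀.r γ - 1‖ ^ 2 = (((7 : ℕ) : ℝ))⁻¹ := by
    rcases hφ₀case with h | h
    · subst h
      exact RubinPadicLFunctionData.ξ_eq_φac_and_norm_sq_of_frame R₀ hK hdK' (by norm_num) h7 hcK σ₀ heq₀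
        (deuringShape_of_values hσ₀)
    · subst h
      exact RubinPadicLFunctionData.ξ_eq_φac_and_norm_sq_of_frame R₀ hK hdK' (by norm_num) h7 hcK
        (σ₀.comp (cK : K →+* K)) (isHeckeConjEquivariant_galConj h2 heq₀)
        (deuringShape_of_values (deuringValues_galConj h2 hcK heq₀ σ₀ (hnr σ₀) hσ₀))
  obtain ⟨hξ, hu⟩ := hP15
  obtain ⟨hξ₀, hu₀⟩ := hP15₀
  -- (P2): Hecke's functional equation for `ψ^{2k+1}`, `ψ₀^{2k+1}`, transported to `φ`, `φ₀`
  have hw : ∃ w : ℂ, IsCentralRootNumberWt (φ ^ (2 * 7 ^ m + 1)) (7 ^ m) w := by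
    obtain ⟨w, -, hw⟩ := exists_isCentralRootNumberWt_pow hHecke hK hinf heq (7 ^ m)
    rcases hφcase with h | h
    · exact ⟨w, h ▸ hw⟩
    · exact ⟨w, h ▸ (isCentralRootNumberWt_galConj_pow_iff cK ψ _ _ w).2 hw⟩
  have hw₀ : ∃ w : ℂ, IsCentralRootNumberWt (φ₀ ^ (2 * 7 ^ m + 1)) (7 ^ m) w := by
    obtain ⟨w, -, hw⟩ := exists_isCentralRootNumberWt_pow hHecke hK hinf₀ heq₀ (7 ^ m)
    rcases hφ₀case with h | h
    · exact ⟨w, h ▸ hw⟩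
    · exact ⟨w, h ▸ (isCentralRootNumberWt_galConj_pow_iff cK ψ₀ _ _ w).2 hw⟩
  obtain ⟨w, hw⟩ := hw
  obtain ⟨w₀, hw₀⟩ := hw₀
  have hsgn := RubinPackageReduction.isCentralRootNumberWt_interpolated_one_of_xi hξ hξ₀ hw hw₀ hρ hr0
  -- (P3): H_QR for `ψ`, `ψ₀`, transported to `φ`, `φ₀`
  have hQRφ : ¬ φ.IsUnramifiedAt 𝔭 ∧ ∀ w, ¬ φ.IsUnramifiedAt w → (φ ^ 2).IsUnramifiedAt w := by
    have h := hQR K 𝔭 W' C hF W hWcm rfl cK hcK ψ hinf heq hψ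
    rcases hφcase with h' | h'
    · exact h' ▸ h
    · exact h' ▸ quadraticRamification_galConj heq h
  have hQRφ₀ : ¬ φ₀.IsUnramifiedAt 𝔭 ∧ ∀ w, ¬ φ₀.IsUnramifiedAt w → (φ₀ ^ 2).IsUnramifiedAt w := by
    have h := hQR K 𝔭 W' C hF W₀ hW₀cm hW₀j cK hcK ψ₀ hinf₀ heq₀ hψ₀
    rcases hφ₀case with h' | h'
    · exact h' ▸ h
    · exact h' ▸ quadraticRamification_galConj heq₀ h
  exact ⟨cK, R, Ω₀, 𝓔₀, D₀', R₀, hξ, hξ₀, hsgn.1, hsgn.2,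
    RubinPackageReduction.not_isUnramifiedAt_interpolated_of_xi hξ hQRφ.1 hQRφ.2 (7 ^ m),
    RubinPackageReduction.not_isUnramifiedAt_interpolated_of_xi hξ₀ hQRφ₀.1 hQRφ₀.2 (7 ^ m),
    hΩ₀, hu, hu₀, hbase, hper, hbottom⟩

end Assembly

end RubinPackageOfRigidity

end Summit.BirchSwinnertonDyer.BirchSwinnertonDyer.Theorems.RamifiedSevenEllipticUnits

end
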